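import Literature.AlgebraicGeometry.HodgeTheory.RealCharactersSlotsHodgeClasses
import Literature.AlgebraicGeometry.HodgeTheory.HodgeEndomorphismsHOneOfRiemann
import Literature.AlgebraicGeometry.HodgeTheory.NoTypeIVFactorOrthogonalProducts
import Literature.AlgebraicGeometry.HodgeTheory.StablyNondegenerateProducts
import Literature.AlgebraicGeometry.HodgeTheory.RibetTotallyRealHodgeClasses
import Literature.AlgebraicGeometry.Motives.HodgeEndomorphismsSelfAdjointOfRealCharacters
import HarnessLib

/-!
# Real `𝔰𝔩₂`-block data on `H¹` of an abelian variety with commutative `End⁰`: the abstract input of the Ribet–Hazama method, its consequences (`B = D` for everything with slots over `A`, condition (D), the Hodge conjecture for all powers) and the real-multiplication instance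

Family `hodge`, layer `Literature/AlgebraicGeometry/HodgeTheory`. Research context: cell `pub-hodge-ring2`
(HONEST FRAMING: research route conditional on HC_CM; not a corollary; Q11.4-sentence-2 already refuted in
dim ≥ 3), Literature lane, programmes R2/R3 (`pub-hodge-ring2-lit-g40/PLAN-R3.md`). UNCONDITIONAL; one
definition (`HasRealSl2Blocks`, a `Prop` WITH BODY — not a named fact); no named fact; no step towards a summit
statement beyond the published theorems it assembles.

THE NOTION. `HasRealSl2Blocks A` packages what Hazama 1983 §3 / Ribet 1983 use about `X` with `End⁰(X)` a totally
real field of degree `dim X`, in a form stable under orthogonal products (sequel `RealSl2BlocksProducts`):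
`End⁰(A)` is commutative and there are finitely many REAL characters `τ_i : End⁰(A) → ℂ` whose joint eigenspaces
`V_i = ⋂_e ker(e^* ⊗ ℂ − τ_i(e))` on `H¹(A) ⊗ ℂ` form an internal direct sum with `dim V_i = 2` («`H¹(A, ℂ) = V₁ ⊕ ⋯ ⊕ V_k`,
`dim_ℂ V_i = 2`», Hazama p. 305–306), together with Hodge-adapted bases `b_i` of the `V_i` (`b_i 0 ∈ H^{1,0}`,
`b_i 1 ∈ H^{0,1}`) whose classes `ρ(b_i 0) ⌣ ρ(b_i 1)` are `ℂ`-combinations of rational `(1,1)`-classes (the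
degree-two invariants are divisor classes, Ribet Thm. 1 / Hazama §3 `p = 1`).

RESULTS.
* `HasRealSl2Blocks.isDivisorGenerated_of_avSlots` — **`B• = D• ⊗ ℂ` for every `B` with slots over `A`** (the tree's
  Riemann `End⁰(A) ≃ End_Hdg(H¹ A)` for commutative `End⁰`, `endAlgebraAlgEquivEndAlgOfComm`; self-adjointness is
  automatic, `isAdjointPair_self_of_real_characters`; then `AVSlots.isDivisorGenerated_of_blockBasis`);
  `…isDivisorGenerated_powSucc`, **`…isStablyNondegenerate`** (condition (D)), **`…hodgeConjectureFor_powSucc`**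
  (the Hodge conjecture for all powers, Lefschetz `(1,1)`), `…hodgeConjectureFor_of_isIsogenous_powSucc`;
* `embCharacter`, `iInf_eigenspace_embCharacter_eq`, … and **`hasRealSl2Blocks_of_isTotallyReal`** — an abelian
  variety whose endomorphism algebra is a totally real field of degree `dim A` has real `𝔰𝔩₂`-block data (the
  tree's `RealMultiplicationHodgeLieAlgebra` blocks + `theta_mem_span_rational_oneOne`);
* `endAlgebra_prod_comm_of_orthogonal` — `End⁰(A × B)` is commutative for orthogonal factors with commutative `End⁰`;
* `isField_endAlgebra_of_finrank_eq_one`, **`hasRealSl2Blocks_of_finrank_endAlgebra_eq_one`** — `End⁰(A) = ℚ`,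
  `dim A = 1` (non-CM elliptic curves) are carriers.

## References

* [Hazama1983] F. Hazama, Tôhoku Math. J. 35 (1983), Thm. (1.1), §3 pp. 305–306. [cite: Hazama1983, Thm. (1.1) and §3 (pp. 305–306)]
* [Ribet1983] K. A. Ribet, Amer. J. Math. 105 (1983), Thm. 0–1. [cite: Ribet1983, Thm. 0–1]
* [MoonenZarhin1999LowDim] B. Moonen, Yu. Zarhin, Duke Math. J. 98 (1999), §2 condition (D), §3 Thm. (3.2)(1).
  [cite: MoonenZarhin1999LowDim, §3 Thm. (3.2)(1)]
* [Deligne1982HodgeCycles] P. Deligne, LNM 900, §4 p. 30. [cite: Deligne1982HodgeCycles, §4 p. 30]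
* [Lange2023AbelianVarietiesC] H. Lange, *Abelian Varieties over the Complex Numbers*, Cor. 2.4.26.
  [cite: Lange2023AbelianVarietiesC, Cor. 2.4.26]
* [MumfordAV1970] D. Mumford, *Abelian Varieties*, §19 Cor. 2 (p. 174). [cite: MumfordAV1970, §19 Cor. 2 (p. 174)]
-/

noncomputable section

open scoped TensorProduct
open CategoryTheory Module NumberField

namespace Literature.AlgebraicGeometry.HodgeTheory

open Literature.AlgebraicTopology.SingularHomology
open Literature.AlgebraicGeometry.Motives (IsSmoothProjective AbelianVariety bettiCohomology
  ofRatClassBaseChange ofRatClassBaseChange_tmul HodgeTensorFacts hodgeTensorFacts_holds)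
open Literature.Barriers.HodgeConjecture
open Literature.AlgebraicGeometry.Motives.HodgeStructure
open Literature.AlgebraicGeometry.ComplexMultiplication

section Data

variable {A B : AbelianVariety ℂ} {n : ℕ} {g : Fin n → (B ⟶ A)}

/-- **Real `𝔰𝔩₂`-block data on `H¹(A)`** (Hazama 1983 §3: «`H¹(A, ℂ) = V₁ ⊕ ⋯ ⊕ V_k`», «`dim_ℂ V_i = 2` for all
`i`», «`𝔥 = 𝔰𝔩₂ × ⋯ × 𝔰𝔩₂`»): `End⁰(A)` is commutative and there is a finite family of REAL characters
`τ_i : End⁰(A) → ℂ` whose joint eigenspaces `V_i` on `H¹(A) ⊗ ℂ` form an internal direct sum of two-dimensional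
blocks admitting Hodge-adapted bases `b_i` (`b_i 0 ∈ H^{1,0}`, `b_i 1 ∈ H^{0,1}`) whose classes
`ρ(b_i 0) ⌣ ρ(b_i 1)` are `ℂ`-combinations of rational `(1,1)`-classes (the Betti hypotheses are the tree theorems
`exists_isReal_hodgeModel_holds`). [cite: Hazama1983, §3 (pp. 305–306)] [cite: Ribet1983, Thm. 0–1] -/
def HasRealSl2Blocks (A : AbelianVariety ℂ) : Prop :=
  (∀ x y : A.endAlgebra, x * y = y * x) ∧
  ∃ (ι : Type) (_ : Fintype ι) (_ : DecidableEq ι) (τ : ι → (A.endAlgebra →+* ℂ)),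
    (∀ i, (starRingEnd ℂ).comp (τ i) = τ i) ∧
    DirectSum.IsInternal (fun i => (⨅ e : A.endAlgebra,
      Module.End.eigenspace ((MulOpposite.unop (bettiRep A e)).baseChange ℂ) (τ i e) : Submodule ℂ _)) ∧
    (∀ i, Module.finrank ℂ (⨅ e : A.endAlgebra,
      Module.End.eigenspace ((MulOpposite.unop (bettiRep A e)).baseChange ℂ) (τ i e) : Submodule ℂ _) = 2) ∧
    ∃ b : ∀ i, Module.Basis (Fin 2) ℂ (⨅ e : A.endAlgebra,
      Module.End.eigenspace ((MulOpposite.unop (bettiRep A e)).baseChange ℂ) (τ i e) : Submodule ℂ _),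
      (∀ i, (b i 0 : ℂ ⊗[ℚ] bettiCohomology A.X 1) ∈
        (BettiUniverse.hodge exists_isReal_hodgeModel_holds
          (AbelianVariety.isSmoothProjective_holds (A := A)) 1).piece 1 0) ∧
      (∀ i, (b i 1 : ℂ ⊗[ℚ] bettiCohomology A.X 1) ∈
        (BettiUniverse.hodge exists_isReal_hodgeModel_holds
          (AbelianVariety.isSmoothProjective_holds (A := A)) 1).piece 0 1) ∧
      ∀ i, cupH1 A (b i 0 : ℂ ⊗[ℚ] bettiCohomology A.X 1) (b i 1) ∈
        Submodule.span ℂ {c : complexBetti A.X 2 | IsRationalClass c ∧ IsOfHodgeType A.dim A.X 2 1 1 c}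

/-- `End⁰(A)` is commutative when `A` has real `𝔰𝔩₂`-block data. [cite: Hazama1983, §3 (pp. 305–306)] -/
theorem HasRealSl2Blocks.comm (h : HasRealSl2Blocks A) : ∀ x y : A.endAlgebra, x * y = y * x := h.1

/-! ### From characters of `End⁰(A)` to characters of `End_Hdg(H¹(A))` -/

/-- **The eigenblock of the character `τ ∘ (End⁰(A) ≅ End_Hdg(H¹ A))⁻¹` of `End_Hdg` is the joint eigenspace of
`End⁰(A)` for `τ`** (Riemann: `End_Hdg(H¹ A) = End⁰(A)` acting by `e ↦ e^*`, `endAlgebraAlgEquivEndAlgOfComm`).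
[cite: Deligne1982HodgeCycles, §4 p. 30] -/
theorem eigenBlock_comp_endAlgebraAlgEquivEndAlgOfComm_symm (hc : ∀ x y : A.endAlgebra, x * y = y * x)
    (hHD : exists_isReal_hodgeModel) (hI : hodgePQ_independent_of_hodgeModel) (τ : A.endAlgebra →+* ℂ) :
    (BettiUniverse.hodge hHD (AbelianVariety.isSmoothProjective_holds (A := A)) 1).eigenBlock
        (τ.comp (endAlgebraAlgEquivEndAlgOfComm hc hHD hI).symm.toRingEquiv.toRingHom) =
      ⨅ e : A.endAlgebra, Module.End.eigenspace ((MulOpposite.unop (bettiRep A e)).baseChange ℂ) (τ e) := by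
  ext x
  rw [mem_eigenBlock_iff, Submodule.mem_iInf]
  simp only [Module.End.mem_eigenspace_iff]
  constructor
  · intro h e
    have h1 := h (endAlgebraAlgEquivEndAlgOfComm hc hHD hI e)
    rw [coe_endAlgebraAlgEquivEndAlgOfComm_apply] at h1
    rw [h1]
    congr 1
    show τ ((endAlgebraAlgEquivEndAlgOfComm hc hHD hI).symm (endAlgebraAlgEquivEndAlgOfComm hc hHD hI e)) = τ e
    rw [AlgEquiv.symm_apply_apply]
  · intro h a
    obtain ⟨e, rfl⟩ := (endAlgebraAlgEquivEndAlgOfComm hc hHD hI).surjective a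
    rw [coe_endAlgebraAlgEquivEndAlgOfComm_apply, h e]
    congr 1
    show τ e = τ ((endAlgebraAlgEquivEndAlgOfComm hc hHD hI).symm (endAlgebraAlgEquivEndAlgOfComm hc hHD hI e))
    rw [AlgEquiv.symm_apply_apply]

/-- Such characters are real when `τ` is. [cite: Hazama1983, §3 (p. 305)] -/
theorem comp_endAlgebraAlgEquivEndAlgOfComm_symm_isReal (hc : ∀ x y : A.endAlgebra, x * y = y * x)
    (hHD : exists_isReal_hodgeModel) (hI : hodgePQ_independent_of_hodgeModel) {τ : A.endAlgebra →+* ℂ}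
    (hτ : (starRingEnd ℂ).comp τ = τ) :
    (starRingEnd ℂ).comp (τ.comp (endAlgebraAlgEquivEndAlgOfComm hc hHD hI).symm.toRingEquiv.toRingHom) =
      τ.comp (endAlgebraAlgEquivEndAlgOfComm hc hHD hI).symm.toRingEquiv.toRingHom := by
  rw [← RingHom.comp_assoc, hτ]

/-! ### Consequences of the data: `B = D`, condition (D), the Hodge conjecture for all powers -/

/-- **`B• = D• ⊗ ℂ` for every abelian variety with slots over an `A` with real `𝔰𝔩₂`-block data** (Ribet/Hazama:
Riemann + automatic self-adjointness + the invariance theorem + the colourwise first fundamental theorem, all in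
the tree). [cite: Ribet1983, Thm. 0–1] [cite: Hazama1983, Thm. (1.1) and §3 (pp. 305–306)]
[cite: MoonenZarhin1999LowDim, §3 Thm. (3.2)(1)] -/
theorem HasRealSl2Blocks.isDivisorGenerated_of_avSlots (h : HasRealSl2Blocks A) (hg : AVSlots A B g) :
    IsDivisorGenerated B := by
  classical
  obtain ⟨hc, ι, _, _, τ, hreal, hint, h2, b, hb0, hb1, hθ⟩ := h
  have hHD : exists_isReal_hodgeModel := exists_isReal_hodgeModel_holds
  have hI : hodgePQ_independent_of_hodgeModel := hodgePQ_independent_of_hodgeModel_holds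
  haveI : HodgeTensorFacts.{0, 0} := hodgeTensorFacts_holds.{0, 0}
  haveI : Module.Finite ℚ (bettiCohomology A.X 1) := finite_bettiCohomology_one A
  have hX : IsSmoothProjective A.dim A.X := AbelianVariety.isSmoothProjective_holds
  obtain ⟨ψ⟩ : (BettiUniverse.hodge hHD (AbelianVariety.isSmoothProjective_holds (A := A)) 1).IsPolarizable :=
    smoothProjective_hodgeStructure_isPolarizable_holds hX (BettiUniverse.realHodgeModel hHD hX)
      (BettiUniverse.realHodgeModel_isHodgeSymmetric hHD hX) 1
  -- the characters of `End_Hdg`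
  set Φ := endAlgebraAlgEquivEndAlgOfComm hc hHD hI with hΦ
  have heq : ∀ i, (BettiUniverse.hodge hHD (AbelianVariety.isSmoothProjective_holds (A := A)) 1).eigenBlock
      ((τ i).comp Φ.symm.toRingEquiv.toRingHom) =
      ⨅ e : A.endAlgebra, Module.End.eigenspace ((MulOpposite.unop (bettiRep A e)).baseChange ℂ) (τ i e) :=
    fun i => eigenBlock_comp_endAlgebraAlgEquivEndAlgOfComm_symm hc hHD hI (τ i)
  have hreal' : ∀ i, (starRingEnd ℂ).comp ((τ i).comp Φ.symm.toRingEquiv.toRingHom) =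
      (τ i).comp Φ.symm.toRingEquiv.toRingHom :=
    fun i => comp_endAlgebraAlgEquivEndAlgOfComm_symm_isReal hc hHD hI (hreal i)
  have hfun : (fun i => (BettiUniverse.hodge hHD (AbelianVariety.isSmoothProjective_holds (A := A)) 1).eigenBlock
      ((τ i).comp Φ.symm.toRingEquiv.toRingHom)) = fun i => (⨅ e : A.endAlgebra,
        Module.End.eigenspace ((MulOpposite.unop (bettiRep A e)).baseChange ℂ) (τ i e) : Submodule ℂ _) :=
    funext heq
  have hint' : DirectSum.IsInternal fun i =>
      (BettiUniverse.hodge hHD (AbelianVariety.isSmoothProjective_holds (A := A)) 1).eigenBlock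
        ((τ i).comp Φ.symm.toRingEquiv.toRingHom) := by
    rw [hfun]; exact hint
  have h2' : ∀ i, Module.finrank ℂ
      ((BettiUniverse.hodge hHD (AbelianVariety.isSmoothProjective_holds (A := A)) 1).eigenBlock
        ((τ i).comp Φ.symm.toRingEquiv.toRingHom)) = 2 := fun i => by rw [heq]; exact h2 i
  have hself := isAdjointPair_self_of_real_characters
    (BettiUniverse.hodge hHD (AbelianVariety.isSmoothProjective_holds (A := A)) 1) (by norm_num)
    (BettiUniverse.hodge_isEffective hHD hX 1) ψ _ hreal' hint'
  -- transported bases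
  let b' : ∀ i, Module.Basis (Fin 2) ℂ
      ((BettiUniverse.hodge hHD (AbelianVariety.isSmoothProjective_holds (A := A)) 1).eigenBlock
        ((τ i).comp Φ.symm.toRingEquiv.toRingHom)) :=
    fun i => (b i).map (LinearEquiv.ofEq _ _ (heq i).symm)
  have hb' : ∀ i r, (b' i r : ℂ ⊗[ℚ] bettiCohomology A.X 1) = (b i r : ℂ ⊗[ℚ] bettiCohomology A.X 1) :=
    fun i r => rfl
  refine hg.isDivisorGenerated_of_blockBasis hHD hI ψ hself _ hreal' hint' h2' b' (fun i => ?_) (fun i => ?_)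
    (fun i => ?_)
  · rw [hb']; exact hb0 i
  · rw [hb']; exact hb1 i
  · rw [hb', hb']; exact hθ i

/-- **`B•(A^{N+1}) = D•(A^{N+1}) ⊗ ℂ` for all `N`.** [cite: Ribet1983, Thm. 0–1] [cite: Hazama1983, Thm. (1.1)] -/
theorem HasRealSl2Blocks.isDivisorGenerated_powSucc (h : HasRealSl2Blocks A) (N : ℕ) :
    IsDivisorGenerated (A.powSucc N) :=
  h.isDivisorGenerated_of_avSlots (AVSlots.powSucc A N)

/-- **Condition (D)**: `A` is stably nondegenerate. [cite: MoonenZarhin1999LowDim, §3 Thm. (3.2)(1)] -/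
theorem HasRealSl2Blocks.isStablyNondegenerate (h : HasRealSl2Blocks A) : IsStablyNondegenerate A :=
  (isStablyNondegenerate_iff A).2 h.isDivisorGenerated_powSucc

/-- **The Hodge conjecture for every power `A^{N+1}`**, unconditionally. [cite: Ribet1983, Thm. 0–1]
[cite: MoonenZarhin1999LowDim, §3 Thm. (3.2)(1)] -/
theorem HasRealSl2Blocks.hodgeConjectureFor_powSucc (h : HasRealSl2Blocks A) (N : ℕ) :
    HodgeConjectureFor (A.powSucc N).dim (A.powSucc N).X :=
  hodgeConjectureFor_of_isDivisorGenerated _ (h.isDivisorGenerated_powSucc N)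

/-- The Hodge conjecture for everything isogenous to a power of `A`. [cite: vanGeemen1994HodgeAV, Lemma 3.7] -/
theorem HasRealSl2Blocks.hodgeConjectureFor_of_isIsogenous_powSucc (h : HasRealSl2Blocks A)
    {X : AbelianVariety ℂ} {N : ℕ} (hX : X.IsIsogenous (A.powSucc N)) : HodgeConjectureFor X.dim X.X :=
  HodgeConjectureFor.of_isIsogenous hX (h.hodgeConjectureFor_powSucc N)

end Data

/-! ### The real-multiplication instance -/

section RealMultiplication

variable {A B : AbelianVariety ℂ}

/-- **`End⁰(A × B)` is commutative** when `Hom(A, B) = 0 = Hom(B, A)` and `End⁰(A)`, `End⁰(B)` are commutative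
(`End⁰(A × B) = End⁰(A) × End⁰(B)`, `NoTypeIVFactorProducts.prodEndAlgebraHom_bijective_of_orthogonal`).
[cite: Lange2023AbelianVarietiesC, Cor. 2.4.26] -/
theorem endAlgebra_prod_comm_of_orthogonal (hA : ∀ x y : A.endAlgebra, x * y = y * x)
    (hB : ∀ x y : B.endAlgebra, x * y = y * x) (hAB : ∀ f : A ⟶ B, f = 0) (hBA : ∀ g : B ⟶ A, g = 0) :
    ∀ x y : (A.prod B).endAlgebra, x * y = y * x := by
  intro x y
  obtain ⟨p, rfl⟩ := (NoTypeIVFactorProducts.prodEndAlgebraHom_bijective_of_orthogonal hAB hBA).2 x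
  obtain ⟨q, rfl⟩ := (NoTypeIVFactorProducts.prodEndAlgebraHom_bijective_of_orthogonal hAB hBA).2 y
  have hpq : p * q = q * p := Prod.ext (hA p.1 q.1) (hB p.2 q.2)
  rw [← map_mul, hpq, map_mul]

/-- The character `End⁰(A) → ℂ` attached to an embedding `τ : E → ℂ` of the field `E = End⁰(A)`
(`EndField A hF` is `End⁰(A)` with its field structure). [cite: Deligne1982HodgeCycles, §4 p. 30] -/
def embCharacter (hF : IsField A.endAlgebra) (τ : EndField A hF →+* ℂ) : A.endAlgebra →+* ℂ :=
  τ.comp (EndField.toEndAlgebra hF).symm.toRingHom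

/-- Unfolding. [cite: Deligne1982HodgeCycles, §4 p. 30] -/
theorem embCharacter_apply (hF : IsField A.endAlgebra) (τ : EndField A hF →+* ℂ) (e : A.endAlgebra) :
    embCharacter hF τ e = τ ((EndField.toEndAlgebra hF).symm e) := rfl

/-- For `E` totally real the characters `embCharacter τ` are real. [cite: Hazama1983, §3 (p. 305)] -/
theorem embCharacter_isReal (hF : IsField A.endAlgebra) [IsTotallyReal (EndField A hF)]
    (τ : EndField A hF →+* ℂ) : (starRingEnd ℂ).comp (embCharacter hF τ) = embCharacter hF τ := by
  ext e
  rw [RingHom.comp_apply, embCharacter_apply]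
  have h := RingHom.congr_fun
    (ComplexEmbedding.isReal_iff.1 (IsTotallyReal.complexEmbedding_isReal τ)) ((EndField.toEndAlgebra hF).symm e)
  rwa [ComplexEmbedding.conjugate_coe_eq] at h

/-- The joint eigenspace of `End⁰(A)` for `embCharacter τ` is the block `V_τ` of the tree's
`eigenBlock_hodgeCharacter`. [cite: Deligne1982HodgeCycles, §4 p. 30] -/
theorem iInf_eigenspace_embCharacter_eq (hF : IsField A.endAlgebra) (hHD : exists_isReal_hodgeModel)
    (hI : hodgePQ_independent_of_hodgeModel) (τ : EndField A hF →+* ℂ) :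
    (⨅ e : A.endAlgebra,
        Module.End.eigenspace ((MulOpposite.unop (bettiRep A e)).baseChange ℂ) (embCharacter hF τ e) :
        Submodule ℂ _) =
      (BettiUniverse.hodge hHD (AbelianVariety.isSmoothProjective_holds (A := A)) 1).eigenBlock
        (hodgeCharacter hF hHD hI τ) := by
  rw [eigenBlock_hodgeCharacter]
  ext x
  simp only [Submodule.mem_iInf, Module.End.mem_eigenspace_iff, hOneAlgHom_apply]
  constructor
  · intro h e
    exact h ((EndField.toEndAlgebra hF) e)
  · intro h e
    exact h ((EndField.toEndAlgebra hF).symm e)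

/-- `H¹(A) ⊗ ℂ = ⊕_τ V_τ` (internal), in the `embCharacter` indexing. [cite: Hazama1983, §3 (p. 305)] -/
theorem isInternal_iInf_eigenspace_embCharacter (hF : IsField A.endAlgebra) (hHD : exists_isReal_hodgeModel)
    (hI : hodgePQ_independent_of_hodgeModel) [DecidableEq (EndField A hF →+* ℂ)] :
    DirectSum.IsInternal fun τ : EndField A hF →+* ℂ =>
      (⨅ e : A.endAlgebra,
        Module.End.eigenspace ((MulOpposite.unop (bettiRep A e)).baseChange ℂ) (embCharacter hF τ e) :
        Submodule ℂ _) := by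
  rw [show (fun τ : EndField A hF →+* ℂ => (⨅ e : A.endAlgebra,
      Module.End.eigenspace ((MulOpposite.unop (bettiRep A e)).baseChange ℂ) (embCharacter hF τ e) :
        Submodule ℂ _)) = fun τ =>
      (BettiUniverse.hodge hHD (AbelianVariety.isSmoothProjective_holds (A := A)) 1).eigenBlock
        (hodgeCharacter hF hHD hI τ) from funext fun τ => iInf_eigenspace_embCharacter_eq hF hHD hI τ]
  exact isInternal_eigenBlock_hodgeCharacter hF hHD hI

/-- `dim V_τ = 2` in the `embCharacter` indexing, when `[E : ℚ] = dim A`. [cite: Hazama1983, §3 (p. 306)] -/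
theorem finrank_iInf_eigenspace_embCharacter (hF : IsField A.endAlgebra) (hHD : exists_isReal_hodgeModel)
    (hI : hodgePQ_independent_of_hodgeModel) (hdeg : Module.finrank ℚ A.endAlgebra = A.dim)
    (τ : EndField A hF →+* ℂ) :
    Module.finrank ℂ
      (⨅ e : A.endAlgebra,
        Module.End.eigenspace ((MulOpposite.unop (bettiRep A e)).baseChange ℂ) (embCharacter hF τ e) :
        Submodule ℂ _) = 2 := by
  rw [iInf_eigenspace_embCharacter_eq hF hHD hI]
  exact finrank_eigenBlock_hodgeCharacter hF hHD hI hdeg τ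

/-- **An abelian variety whose endomorphism algebra is a totally real field of degree `dim A` has real `𝔰𝔩₂`-block
data** (characters = the embeddings `E → ℂ`; blocks `V_τ` internal of dimension two by the tree's
`RealMultiplicationHodgeLieAlgebra`; Hodge-adapted bases by `exists_hodgeAdapted_blockBasis`; `θ_τ ∈ B¹(A) ⊗ ℂ` by
`theta_mem_span_rational_oneOne`). [cite: Hazama1983, Thm. (1.1) and §3 (pp. 305–306)] [cite: Ribet1983, Thm. 0–1] -/
theorem hasRealSl2Blocks_of_isTotallyReal (A : AbelianVariety ℂ) (hF : IsField A.endAlgebra)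
    [IsTotallyReal (EndField A hF)] (hdeg : Module.finrank ℚ A.endAlgebra = A.dim) : HasRealSl2Blocks A := by
  classical
  have hHD : exists_isReal_hodgeModel := exists_isReal_hodgeModel_holds
  have hI : hodgePQ_independent_of_hodgeModel := hodgePQ_independent_of_hodgeModel_holds
  haveI : HodgeTensorFacts.{0, 0} := hodgeTensorFacts_holds.{0, 0}
  haveI : Module.Finite ℚ (bettiCohomology A.X 1) := finite_bettiCohomology_one A
  have hX : IsSmoothProjective A.dim A.X := AbelianVariety.isSmoothProjective_holds
  obtain ⟨ψ⟩ : (BettiUniverse.hodge hHD (AbelianVariety.isSmoothProjective_holds (A := A)) 1).IsPolarizable :=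
    smoothProjective_hodgeStructure_isPolarizable_holds hX (BettiUniverse.realHodgeModel hHD hX)
      (BettiUniverse.realHodgeModel_isHodgeSymmetric hHD hX) 1
  obtain ⟨b, hb0', hb1'⟩ := exists_hodgeAdapted_blockBasis
    (BettiUniverse.hodge hHD (AbelianVariety.isSmoothProjective_holds (A := A)) 1) Nat.cast_one
    (BettiUniverse.hodge_isEffective hHD hX 1) (hodgeCharacter hF hHD hI) (hodgeCharacter_isReal hF hHD hI)
    (finrank_eigenBlock_hodgeCharacter hF hHD hI hdeg)
  have e10 : (((1 : ℕ) : ℤ) - 1) = 0 := by norm_num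
  have e01 : (((1 : ℕ) : ℤ) - 0) = 1 := by norm_num
  have hb0 : ∀ τ, (b τ 0 : ℂ ⊗[ℚ] bettiCohomology A.X 1) ∈
      (BettiUniverse.hodge hHD (AbelianVariety.isSmoothProjective_holds (A := A)) 1).piece 1 0 := fun τ => by
    have h := hb0' τ; rwa [e10] at h
  have hb1 : ∀ τ, (b τ 1 : ℂ ⊗[ℚ] bettiCohomology A.X 1) ∈
      (BettiUniverse.hodge hHD (AbelianVariety.isSmoothProjective_holds (A := A)) 1).piece 0 1 := fun τ => by
    have h := hb1' τ; rwa [e01] at h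
  -- transported bases
  let b' : ∀ τ : EndField A hF →+* ℂ, Module.Basis (Fin 2) ℂ (⨅ e : A.endAlgebra,
      Module.End.eigenspace ((MulOpposite.unop (bettiRep A e)).baseChange ℂ) (embCharacter hF τ e) :
        Submodule ℂ _) :=
    fun τ => (b τ).map (LinearEquiv.ofEq _ _ (iInf_eigenspace_embCharacter_eq hF hHD hI τ).symm)
  have hb' : ∀ τ r, (b' τ r : ℂ ⊗[ℚ] bettiCohomology A.X 1) = (b τ r : ℂ ⊗[ℚ] bettiCohomology A.X 1) :=
    fun τ r => rfl
  refine ⟨hF.mul_comm, EndField A hF →+* ℂ, inferInstance, inferInstance, embCharacter hF, embCharacter_isReal hF,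
    isInternal_iInf_eigenspace_embCharacter hF hHD hI, finrank_iInf_eigenspace_embCharacter hF hHD hI hdeg, b',
    fun τ => ?_, fun τ => ?_, fun τ => ?_⟩
  · rw [hb']; exact hb0 τ
  · rw [hb']; exact hb1 τ
  · rw [hb', hb']; exact theta_mem_span_rational_oneOne hF hHD hI hdeg ψ b hb0 hb1 τ

end RealMultiplication

/-! ### The instance `End⁰(A) = ℚ`, `dim A = 1` (elliptic curves without complex multiplication) -/

section RankOne

variable {A : AbelianVariety ℂ}

/-- **A `ℚ`-algebra of dimension one is a field**: `End⁰(A) = ℚ · 1` when `[End⁰(A) : ℚ] = 1`.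
[cite: MumfordAV1970, §19 Cor. 2 (p. 174)] -/
theorem isField_endAlgebra_of_finrank_eq_one (h1 : Module.finrank ℚ A.endAlgebra = 1) : IsField A.endAlgebra := by
  haveI : Nontrivial A.endAlgebra := Module.nontrivial_of_finrank_pos (R := ℚ) (by omega)
  have hspan : ∀ w : A.endAlgebra, ∃ c : ℚ, c • (1 : A.endAlgebra) = w :=
    -- instance search does not bridge the two `AddCommMonoid` structures on `End⁰(A)`
    -- (`AbelianVarietyEndAlgebraInstances`), so the instances are given explicitly
    (@finrank_eq_one_iff_of_nonzero' ℚ A.endAlgebra _ Ring.toAddCommGroup Algebra.toModule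
      (1 : A.endAlgebra) one_ne_zero).1 h1
  -- `ℚ ≃ₐ End⁰(A)` via the structure map, bijective since `End⁰(A) = ℚ · 1`
  have hbij : Function.Bijective (Algebra.ofId ℚ A.endAlgebra) := by
    refine ⟨(algebraMap ℚ A.endAlgebra).injective, fun w => ?_⟩
    obtain ⟨c, rfl⟩ := hspan w
    exact ⟨c, by rw [Algebra.ofId_apply, Algebra.algebraMap_eq_smul_one]⟩
  exact MulEquiv.isField (Field.toIsField ℚ) (AlgEquiv.ofBijective (Algebra.ofId ℚ A.endAlgebra) hbij).symm.toMulEquiv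

/-- **An abelian variety with `End⁰(A) = ℚ` and `dim A = 1` — an elliptic curve without complex multiplication —
carries real `𝔰𝔩₂`-block data** (`E = ℚ` is a totally real field of degree `1 = dim A`); so finite families mixing
pairwise non-isogenous non-CM elliptic curves with real-multiplication varieties of relative dimension one fall under
`RealSl2BlocksFiniteProducts`. [cite: Hazama1983, §3 (pp. 305–306)] [cite: Ribet1983, Thm. 0–1] -/
theorem hasRealSl2Blocks_of_finrank_endAlgebra_eq_one (A : AbelianVariety ℂ)
    (h1 : Module.finrank ℚ A.endAlgebra = 1) (hdim : A.dim = 1) : HasRealSl2Blocks A :=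
  haveI := isTotallyReal_endField_of_finrank_eq_one (isField_endAlgebra_of_finrank_eq_one h1) h1
  hasRealSl2Blocks_of_isTotallyReal A (isField_endAlgebra_of_finrank_eq_one h1) (h1.trans hdim.symm)

end RankOne

end Literature.AlgebraicGeometry.HodgeTheory

end
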